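import Summits.Ventures.PercRepro.S1DisjointSumFourFiveProfile

/-!
# PercRepro — THE `(7, 2)` AND `(2, 7)` SPLITS AT `(9, 4)`: A RANK-2 PART ON 4 OR 5 POINTS (p2, gen 28;
SUBCLAIM-S1 §6.10 (xvii)(j))

The two remaining shapes of a `1`-separable `(9, 5)` core with a rank-`2` part on at least `4` points (they are
excluded by `e`-freeness, but they close anyway, term by term):
* `(7, 2)`: `M` of rank `7` on `10` points, `N` of rank `2` on `4` points with all pairs of rank `2` (`U_{2,4}`):
  `#U ≤ 4 N_M(7, 3) + 6 N_M(7, 2)`, `#Y ≥ 11 f_M(3) + 15 f_M(4) + 16 f_M(5) + 16 f_M(6) + 5 f_M(7)`, Theorem M at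
  `(7, 3)` (`Φ = 28/5`) and Theorem N at `(7, 2)` (`Φ = 35/3`) on `M`:
  `Φ(9, 4) · #U ≤ 4.32 f_M(3) + 10.32 (f_M(4) + f_M(5) + f_M(6))`;
* `(2, 7)`: `M` of rank `2` on `5` points with all pairs of rank `2` (`U_{2,5}`), `N` of rank `7` on `9` points:
  `#U ≤ 20 N_N(7, 2)`, `#Y ≥ 26 (f_N(3) + f_N(4) + f_N(5) + f_N(6))`, Theorem N at `(7, 2)` on `N`:
  `Φ(9, 4) · #U ≤ (12/7)(…) ≤ 26 (…)`.
Nothing is claimed about any cell.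

* `phiK_seven_two` — `Φ(7, 2) = 35/3`; `ySet_eq_rankSet_union4_of_eq` — the `Y`-set of a cell `(q + 5, q)`;
* `ncard_rankSet_two_ge_of_rank_two` — a rank-`2` matroid with all pairs of rank `2` has `2^n − 1 − n` rank-`2` sets;
* `c025_nine_four_disjointSum_seven_two`, `c025_nine_four_disjointSum_two_seven`.
Axioms: standard.
-/

open scoped Matroid

namespace PercRepro

namespace S1

open Set

variable {α : Type}

/-- `Φ(7, 2) = 35/3`. -/
theorem phiK_seven_two : phiK 7 2 = 35 / 3 := by
  unfold phiK
  rw [show Finset.Ioo 2 7 = {3, 4, 5, 6} from by decide, show (7 : ℕ) + 2 = 9 from rfl]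
  rw [Finset.sum_insert (by decide), Finset.sum_insert (by decide), Finset.sum_insert (by decide),
    Finset.sum_singleton]
  rw [show Nat.choose 9 3 = 84 by decide, show Nat.choose 9 4 = 126 by decide,
    show Nat.choose 9 5 = 126 by decide, show Nat.choose 9 6 = 84 by decide, show Nat.choose 9 7 = 36 by decide]
  norm_num

/-- The `Y`-set of a cell `(q + 5, q)` is the union of the rank levels `q + 1 … q + 4`. -/
theorem ySet_eq_rankSet_union4_of_eq (M : Matroid α) {q p k₁ k₂ k₃ k₄ : ℕ} (h₁ : k₁ = q + 1) (h₂ : k₂ = q + 2)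
    (h₃ : k₃ = q + 3) (h₄ : k₄ = q + 4) (hp : p = q + 5) :
    {A : Set α | A ⊆ M.E ∧ (q : ℕ∞) < M.eRk A ∧ M.eRk A < (p : ℕ∞)} =
      rankSet M k₁ ∪ rankSet M k₂ ∪ rankSet M k₃ ∪ rankSet M k₄ := by
  ext A
  simp only [mem_setOf_eq, rankSet, mem_union]
  constructor
  · rintro ⟨hAE, h1, h2⟩
    obtain ⟨n, hn⟩ := ENat.ne_top_iff_exists.mp (ne_top_of_lt h2)
    rw [← hn] at h1 h2 ⊢
    have h1' : q < n := by exact_mod_cast h1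
    have h2' : n < p := by exact_mod_cast h2
    have hmem : ∀ k, n = k → A ⊆ M.E ∧ (n : ℕ∞) = (k : ℕ∞) := fun k hk => ⟨hAE, by rw [hk]⟩
    rcases Nat.lt_or_ge n k₂ with h | h
    · exact Or.inl (Or.inl (Or.inl (hmem k₁ (by omega))))
    rcases Nat.lt_or_ge n k₃ with h' | h'
    · exact Or.inl (Or.inl (Or.inr (hmem k₂ (by omega))))
    rcases Nat.lt_or_ge n k₄ with h'' | h''
    · exact Or.inl (Or.inr (hmem k₃ (by omega)))
    · exact Or.inr (hmem k₄ (by omega))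
  · rintro (((⟨hAE, hA⟩ | ⟨hAE, hA⟩) | ⟨hAE, hA⟩) | ⟨hAE, hA⟩) <;>
      exact ⟨hAE, by rw [hA]; exact_mod_cast (show q < _ by omega), by rw [hA]; exact_mod_cast (show _ < p by omega)⟩

/-- In a matroid of rank `2` with all pairs of rank `2`, every set with at least two points has rank `2`:
`f(2) ≥ 2^n − 1 − n`. -/
theorem ncard_rankSet_two_ge_of_rank_two (M : Matroid α) [M.Finite] (hM : M.eRank = ((2 : ℕ) : ℕ∞))
    (hpairs : ∀ e ∈ M.E, ∀ f ∈ M.E, e ≠ f → M.eRk {e, f} = 2) :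
    2 ^ M.E.ncard - 1 - M.E.ncard ≤ (rankSet M 2).ncard := by
  have hsub : {A : Set α | A ⊆ M.E ∧ 2 ≤ A.ncard} ⊆ rankSet M 2 := by
    rintro A ⟨hAE, h2⟩
    have hlo := two_le_eRk_of_two_le_ncard hpairs hAE h2
    have hhi := M.eRk_le_eRank A
    rw [hM] at hhi
    exact ⟨hAE, le_antisymm hhi hlo⟩
  have h := ncard_le_ncard hsub (rankSet_finite M 2)
  rwa [ncard_setOf_subset_two_le_ncard M.ground_finite] at h

/-- The arithmetic of the `(7, 2)`-split consumer. -/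
theorem consumer_arith_seven_two {u y P3 P2 f3 f4 f5 f6 f7 : ℚ} (hU : u ≤ 4 * P3 + 6 * P2)
    (h73 : 28 / 5 * P3 ≤ f4 + f5 + f6) (h72 : 35 / 3 * P2 ≤ f3 + f4 + f5 + f6)
    (hY : 11 * f3 + 15 * f4 + 16 * f5 + 16 * f6 + 5 * f7 ≤ y) (hf3 : 0 ≤ f3) (hf4 : 0 ≤ f4) (hf5 : 0 ≤ f5)
    (hf6 : 0 ≤ f6) (hf7 : 0 ≤ f7) : 42 / 5 * u ≤ y := by
  linarith

/-- **The `(7, 2)`-split consumer**: `M` of rank `7` on `10` points, `N` of rank `2` on `4` points with all pairs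
of rank `2`. -/
theorem c025_nine_four_disjointSum_seven_two (M N : Matroid α) [M.Finite] [N.Finite] (h : Disjoint M.E N.E)
    (hM : M.eRank = ((7 : ℕ) : ℕ∞)) (hME : M.E.ncard = 10) (hN : N.eRank = ((2 : ℕ) : ℕ∞)) (hNE : N.E.ncard = 4)
    (hpairs : ∀ e ∈ N.E, ∀ f ∈ N.E, e ≠ f → N.eRk {e, f} = 2) :
    phiK 9 4 * ({A : Set α | A ⊆ (M.disjointSum N h).E ∧ (M.disjointSum N h).eRk A = ((9 : ℕ) : ℕ∞) ∧
        (M.disjointSum N h).eRk ((M.disjointSum N h).E \ A) = ((4 : ℕ) : ℕ∞)}.ncard : ℚ) ≤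
      ({A : Set α | A ⊆ (M.disjointSum N h).E ∧ ((4 : ℕ) : ℕ∞) < (M.disjointSum N h).eRk A ∧
        (M.disjointSum N h).eRk A < ((9 : ℕ) : ℕ∞)}.ncard : ℚ) := by
  -- the `U`-side
  have hU : {A : Set α | A ⊆ (M.disjointSum N h).E ∧ (M.disjointSum N h).eRk A = ((9 : ℕ) : ℕ∞) ∧
      (M.disjointSum N h).eRk ((M.disjointSum N h).E \ A) = ((4 : ℕ) : ℕ∞)}.ncard ≤
      4 * (profileSet M 7 3).ncard + 6 * (profileSet M 7 2).ncard := by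
    rw [disjointSum_ncard_U_eq_finsum M N h 9 4, finsum_mem_coe_finset]
    rw [Finset.sum_eq_add_of_mem (7, 3) (7, 2) (by decide) (by decide) (by decide) ?_]
    · dsimp only
      show (profileSet M 7 3).ncard * (profileSet N 2 1).ncard + (profileSet M 7 2).ncard * (profileSet N 2 2).ncard ≤ _
      have h1 := ncard_profileSet_top_one_le_of_pairs' hpairs 2
      rw [hNE] at h1
      have h2 := ncard_profileSet_le_choose_of_ncard_eq (N := N) (a := 2) (b := 2) hNE
      rw [show Nat.choose (2 + 2) 2 = 6 by decide] at h2
      calc (profileSet M 7 3).ncard * (profileSet N 2 1).ncard + (profileSet M 7 2).ncard * (profileSet N 2 2).ncard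
          ≤ (profileSet M 7 3).ncard * 4 + (profileSet M 7 2).ncard * 6 :=
            Nat.add_le_add (Nat.mul_le_mul_left _ h1) (Nat.mul_le_mul_left _ h2)
        _ = 4 * (profileSet M 7 3).ncard + 6 * (profileSet M 7 2).ncard := by ring
    · rintro ⟨a, b⟩ hmem ⟨hne1, hne2⟩
      rw [Finset.mem_product, Finset.mem_range, Finset.mem_range] at hmem
      dsimp only
      rcases Nat.lt_or_ge 7 a with ha | ha
      · rw [profileSet_eq_empty_of_eRank_lt M hM ha b, ncard_empty, zero_mul]
      rcases Nat.lt_or_ge a 7 with ha' | ha'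
      · have h9a : 2 < 9 - a := by omega
        rw [profileSet_eq_empty_of_eRank_lt N hN h9a (4 - b), ncard_empty, mul_zero]
      have ha7 : a = 7 := by omega
      subst ha7
      rw [show (9 : ℕ) - 7 = 2 from rfl]
      rcases Nat.lt_or_ge b 2 with hb | hb
      · have h4 : N.E.ncard < 2 + (4 - b) := by rw [hNE]; omega
        rw [profileSet_eq_empty_of_ncard_lt N h4, ncard_empty, mul_zero]
      · have hb4 : b = 4 := by
          rcases Nat.lt_or_ge b 4 with hb4 | hb4
          · exfalso
            rcases Nat.lt_or_ge b 3 with hb3 | hb3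
            · exact hne2 (by congr 1; omega)
            · exact hne1 (by congr 1; omega)
          · omega
        subst hb4
        rw [profileSet_eq_empty_of_ncard_lt M (by rw [hME]; norm_num : M.E.ncard < 7 + 4), ncard_empty, zero_mul]
  -- the `Y`-side
  have hY : 11 * (rankSet M 3).ncard + 15 * (rankSet M 4).ncard + 16 * (rankSet M 5).ncard +
      16 * (rankSet M 6).ncard + 5 * (rankSet M 7).ncard ≤
      {A : Set α | A ⊆ (M.disjointSum N h).E ∧ ((4 : ℕ) : ℕ∞) < (M.disjointSum N h).eRk A ∧
        (M.disjointSum N h).eRk A < ((9 : ℕ) : ℕ∞)}.ncard := by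
    rw [disjointSum_ncard_Y_eq_finsum M N h 9 4, finsum_mem_coe_finset]
    have hsub : ({(3, 2), (4, 1), (4, 2), (5, 0), (5, 1), (5, 2), (6, 0), (6, 1), (6, 2), (7, 0), (7, 1)} :
        Finset (ℕ × ℕ)) ⊆
        (Finset.range 9 ×ˢ Finset.range 9).filter (fun x : ℕ × ℕ => 4 < x.1 + x.2 ∧ x.1 + x.2 < 9) := by
      decide
    refine le_trans ?_ (Finset.sum_le_sum_of_subset hsub)
    rw [Finset.sum_insert (by decide), Finset.sum_insert (by decide), Finset.sum_insert (by decide),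
      Finset.sum_insert (by decide), Finset.sum_insert (by decide), Finset.sum_insert (by decide),
      Finset.sum_insert (by decide), Finset.sum_insert (by decide), Finset.sum_insert (by decide),
      Finset.sum_insert (by decide), Finset.sum_singleton]
    dsimp only
    have f0 : 1 ≤ (rankSet N 0).ncard := by
      have h0 : (∅ : Set α) ∈ rankSet N 0 := ⟨empty_subset _, by rw [N.eRk_empty]; rfl⟩
      exact (ncard_pos (rankSet_finite N 0)).mpr ⟨∅, h0⟩
    have f1 : 4 ≤ (rankSet N 1).ncard := by
      have := ncard_le_ncard_rankSet_one_of_pairs hpairs (by omega)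
      rwa [hNE] at this
    have f2 : 11 ≤ (rankSet N 2).ncard := by
      have := ncard_rankSet_two_ge_of_rank_two N hN hpairs
      rwa [hNE, show 2 ^ 4 - 1 - 4 = 11 by decide] at this
    have e32 := Nat.mul_le_mul_left (rankSet M 3).ncard f2
    have e41 := Nat.mul_le_mul_left (rankSet M 4).ncard f1
    have e42 := Nat.mul_le_mul_left (rankSet M 4).ncard f2
    have e50 := Nat.mul_le_mul_left (rankSet M 5).ncard f0
    have e51 := Nat.mul_le_mul_left (rankSet M 5).ncard f1
    have e52 := Nat.mul_le_mul_left (rankSet M 5).ncard f2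
    have e60 := Nat.mul_le_mul_left (rankSet M 6).ncard f0
    have e61 := Nat.mul_le_mul_left (rankSet M 6).ncard f1
    have e62 := Nat.mul_le_mul_left (rankSet M 6).ncard f2
    have e70 := Nat.mul_le_mul_left (rankSet M 7).ncard f0
    have e71 := Nat.mul_le_mul_left (rankSet M 7).ncard f1
    linarith
  -- the tree cells of `M`
  have h73 : (28 / 5 : ℚ) * ((profileSet M 7 3).ncard : ℚ) ≤
      ((rankSet M 4).ncard : ℚ) + ((rankSet M 5).ncard : ℚ) + ((rankSet M 6).ncard : ℚ) := by
    have h0 := ThmN.RLS_of_ncard_eq M (p := 7) (q := 3) hME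
    unfold ThmN.RLS at h0
    rw [phiK_seven_three,
      ySet_eq_rankSet_union3_of_eq M (q := 3) (p := 7) (k := 4) (k' := 5) (k'' := 6) rfl rfl rfl rfl,
      ncard_union_eq (Set.disjoint_union_left.mpr
        ⟨rankSet_disjoint_of_ne M (by norm_num), rankSet_disjoint_of_ne M (by norm_num)⟩)
        ((rankSet_finite M 4).union (rankSet_finite M 5)) (rankSet_finite M 6),
      ncard_union_eq (rankSet_disjoint_of_ne M (by norm_num)) (rankSet_finite M 4) (rankSet_finite M 5)] at h0
    push_cast at h0
    exact h0
  have h72 : (35 / 3 : ℚ) * ((profileSet M 7 2).ncard : ℚ) ≤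
      ((rankSet M 3).ncard : ℚ) + ((rankSet M 4).ncard : ℚ) + ((rankSet M 5).ncard : ℚ) +
        ((rankSet M 6).ncard : ℚ) := by
    have h0 := ThmN.c025_two_all M 7 (by norm_num)
    unfold ThmN.RLS at h0
    rw [phiK_seven_two,
      ySet_eq_rankSet_union4_of_eq M (q := 2) (p := 7) (k₁ := 3) (k₂ := 4) (k₃ := 5) (k₄ := 6) rfl rfl rfl rfl rfl,
      ncard_union_eq (Set.disjoint_union_left.mpr ⟨Set.disjoint_union_left.mpr
        ⟨rankSet_disjoint_of_ne M (by norm_num), rankSet_disjoint_of_ne M (by norm_num)⟩,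
        rankSet_disjoint_of_ne M (by norm_num)⟩)
        (((rankSet_finite M 3).union (rankSet_finite M 4)).union (rankSet_finite M 5)) (rankSet_finite M 6),
      ncard_union_eq (Set.disjoint_union_left.mpr
        ⟨rankSet_disjoint_of_ne M (by norm_num), rankSet_disjoint_of_ne M (by norm_num)⟩)
        ((rankSet_finite M 3).union (rankSet_finite M 4)) (rankSet_finite M 5),
      ncard_union_eq (rankSet_disjoint_of_ne M (by norm_num)) (rankSet_finite M 3) (rankSet_finite M 4)] at h0
    push_cast at h0
    exact h0
  rw [phiK_nine_four]
  have hU' : (({A : Set α | A ⊆ (M.disjointSum N h).E ∧ (M.disjointSum N h).eRk A = ((9 : ℕ) : ℕ∞) ∧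
      (M.disjointSum N h).eRk ((M.disjointSum N h).E \ A) = ((4 : ℕ) : ℕ∞)}.ncard : ℕ) : ℚ) ≤
      4 * ((profileSet M 7 3).ncard : ℚ) + 6 * ((profileSet M 7 2).ncard : ℚ) := by
    exact_mod_cast hU
  have hY' : 11 * ((rankSet M 3).ncard : ℚ) + 15 * ((rankSet M 4).ncard : ℚ) + 16 * ((rankSet M 5).ncard : ℚ) +
      16 * ((rankSet M 6).ncard : ℚ) + 5 * ((rankSet M 7).ncard : ℚ) ≤
      (({A : Set α | A ⊆ (M.disjointSum N h).E ∧ ((4 : ℕ) : ℕ∞) < (M.disjointSum N h).eRk A ∧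
        (M.disjointSum N h).eRk A < ((9 : ℕ) : ℕ∞)}.ncard : ℕ) : ℚ) := by
    exact_mod_cast hY
  exact consumer_arith_seven_two hU' h73 h72 hY' (Nat.cast_nonneg _) (Nat.cast_nonneg _) (Nat.cast_nonneg _)
    (Nat.cast_nonneg _) (Nat.cast_nonneg _)


/-- The arithmetic of the `(2, 7)`-split consumer. -/
theorem consumer_arith_two_seven {u y P2 S : ℚ} (hU : u ≤ 20 * P2) (h72 : 35 / 3 * P2 ≤ S) (hY : 26 * S ≤ y)
    (hS : 0 ≤ S) : 42 / 5 * u ≤ y := by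
  linarith

/-- **The `(2, 7)`-split consumer**: `M` of rank `2` on `5` points with all pairs of rank `2`, `N` of rank `7` on
`9` points — from Theorem N at `(7, 2)` on `N` alone. -/
theorem c025_nine_four_disjointSum_two_seven (M N : Matroid α) [M.Finite] [N.Finite] (h : Disjoint M.E N.E)
    (hM : M.eRank = ((2 : ℕ) : ℕ∞)) (hME : M.E.ncard = 5)
    (hpairs : ∀ e ∈ M.E, ∀ f ∈ M.E, e ≠ f → M.eRk {e, f} = 2) (hN : N.eRank = ((7 : ℕ) : ℕ∞))
    (hNE : N.E.ncard = 9) :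
    phiK 9 4 * ({A : Set α | A ⊆ (M.disjointSum N h).E ∧ (M.disjointSum N h).eRk A = ((9 : ℕ) : ℕ∞) ∧
        (M.disjointSum N h).eRk ((M.disjointSum N h).E \ A) = ((4 : ℕ) : ℕ∞)}.ncard : ℚ) ≤
      ({A : Set α | A ⊆ (M.disjointSum N h).E ∧ ((4 : ℕ) : ℕ∞) < (M.disjointSum N h).eRk A ∧
        (M.disjointSum N h).eRk A < ((9 : ℕ) : ℕ∞)}.ncard : ℚ) := by
  -- the `U`-side: only the slice `(2, 2)` survives
  have hU : {A : Set α | A ⊆ (M.disjointSum N h).E ∧ (M.disjointSum N h).eRk A = ((9 : ℕ) : ℕ∞) ∧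
      (M.disjointSum N h).eRk ((M.disjointSum N h).E \ A) = ((4 : ℕ) : ℕ∞)}.ncard ≤
      20 * (profileSet N 7 2).ncard := by
    rw [disjointSum_ncard_U_eq_finsum M N h 9 4, finsum_mem_coe_finset]
    rw [Finset.sum_eq_single_of_mem (2, 2) (by decide) ?_]
    · dsimp only
      show (profileSet M 2 2).ncard * (profileSet N 7 2).ncard ≤ _
      have h22 : (profileSet M 2 2).ncard ≤ 20 := by
        have hsub : profileSet M 2 2 ⊆ {A : Set α | A ⊆ M.E ∧ A.ncard = 2} ∪ {A : Set α | A ⊆ M.E ∧ A.ncard = 3} := by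
          rintro A ⟨hAE, hA2, hAc⟩
          have hAfin : A.Finite := M.ground_finite.subset hAE
          have h1 : ((2 : ℕ) : ℕ∞) ≤ (A.ncard : ℕ∞) := by
            rw [← hA2, hAfin.cast_ncard_eq]; exact M.eRk_le_encard A
          have h2 : ((2 : ℕ) : ℕ∞) ≤ ((M.E \ A).ncard : ℕ∞) := by
            rw [← hAc, (M.ground_finite.subset sdiff_subset).cast_ncard_eq]; exact M.eRk_le_encard _
          have h3 : A.ncard + (M.E \ A).ncard = M.E.ncard := by
            rw [← ncard_union_eq disjoint_sdiff_right hAfin (M.ground_finite.subset sdiff_subset),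
              union_sdiff_cancel hAE]
          have h1' : 2 ≤ A.ncard := by exact_mod_cast h1
          have h2' : 2 ≤ (M.E \ A).ncard := by exact_mod_cast h2
          rcases Nat.lt_or_ge A.ncard 3 with h | h
          · left; exact ⟨hAE, by omega⟩
          · right; exact ⟨hAE, by omega⟩
        have hfin : ∀ k : ℕ, {A : Set α | A ⊆ M.E ∧ A.ncard = k}.Finite := fun k =>
          M.ground_finite.finite_subsets.subset (fun _ hA => hA.1)
        have h := ncard_le_ncard hsub ((hfin 2).union (hfin 3))
        refine h.trans ((ncard_union_le _ _).trans ?_)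
        rw [ncard_setOf_subset_ncard_eq M.ground_finite 2, ncard_setOf_subset_ncard_eq M.ground_finite 3, hME]
        decide
      exact Nat.mul_le_mul_right _ h22
    · rintro ⟨a, b⟩ hmem hne
      rw [Finset.mem_product, Finset.mem_range, Finset.mem_range] at hmem
      dsimp only
      rcases Nat.lt_or_ge 2 a with ha | ha
      · rw [profileSet_eq_empty_of_eRank_lt M hM ha b, ncard_empty, zero_mul]
      rcases Nat.lt_or_ge a 2 with ha' | ha'
      · have h9a : 7 < 9 - a := by omega
        rw [profileSet_eq_empty_of_eRank_lt N hN h9a (4 - b), ncard_empty, mul_zero]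
      have ha2 : a = 2 := by omega
      subst ha2
      rw [show (9 : ℕ) - 2 = 7 from rfl]
      rcases Nat.lt_or_ge b 2 with hb | hb
      · have h9 : N.E.ncard < 7 + (4 - b) := by rw [hNE]; omega
        rw [profileSet_eq_empty_of_ncard_lt N h9, ncard_empty, mul_zero]
      · have hb3 : 2 < b := by
          rcases Nat.lt_or_ge b 3 with hb3 | hb3
          · exfalso; exact hne (by congr 1; omega)
          · omega
        rw [profileSet_eq_empty_of_eRank_lt_snd M hM hb3 2, ncard_empty, zero_mul]
  -- the `Y`-side: the slices `(2, 3) … (2, 6)`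
  have hY : 26 * ((rankSet N 3).ncard + (rankSet N 4).ncard + (rankSet N 5).ncard + (rankSet N 6).ncard) ≤
      {A : Set α | A ⊆ (M.disjointSum N h).E ∧ ((4 : ℕ) : ℕ∞) < (M.disjointSum N h).eRk A ∧
        (M.disjointSum N h).eRk A < ((9 : ℕ) : ℕ∞)}.ncard := by
    rw [disjointSum_ncard_Y_eq_finsum M N h 9 4, finsum_mem_coe_finset]
    have hsub : ({(2, 3), (2, 4), (2, 5), (2, 6)} : Finset (ℕ × ℕ)) ⊆
        (Finset.range 9 ×ˢ Finset.range 9).filter (fun x : ℕ × ℕ => 4 < x.1 + x.2 ∧ x.1 + x.2 < 9) := by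
      decide
    refine le_trans ?_ (Finset.sum_le_sum_of_subset hsub)
    rw [Finset.sum_insert (by decide), Finset.sum_insert (by decide), Finset.sum_insert (by decide),
      Finset.sum_singleton]
    dsimp only
    have f2 : 26 ≤ (rankSet M 2).ncard := by
      have := ncard_rankSet_two_ge_of_rank_two M hM hpairs
      rwa [hME, show 2 ^ 5 - 1 - 5 = 26 by decide] at this
    have e3 := Nat.mul_le_mul_right (rankSet N 3).ncard f2
    have e4 := Nat.mul_le_mul_right (rankSet N 4).ncard f2
    have e5 := Nat.mul_le_mul_right (rankSet N 5).ncard f2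
    have e6 := Nat.mul_le_mul_right (rankSet N 6).ncard f2
    linarith
  -- Theorem N at `(7, 2)` on `N`
  have h72 : (35 / 3 : ℚ) * ((profileSet N 7 2).ncard : ℚ) ≤
      ((rankSet N 3).ncard : ℚ) + ((rankSet N 4).ncard : ℚ) + ((rankSet N 5).ncard : ℚ) +
        ((rankSet N 6).ncard : ℚ) := by
    have h0 := ThmN.c025_two_all N 7 (by norm_num)
    unfold ThmN.RLS at h0
    rw [phiK_seven_two,
      ySet_eq_rankSet_union4_of_eq N (q := 2) (p := 7) (k₁ := 3) (k₂ := 4) (k₃ := 5) (k₄ := 6) rfl rfl rfl rfl rfl,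
      ncard_union_eq (Set.disjoint_union_left.mpr ⟨Set.disjoint_union_left.mpr
        ⟨rankSet_disjoint_of_ne N (by norm_num), rankSet_disjoint_of_ne N (by norm_num)⟩,
        rankSet_disjoint_of_ne N (by norm_num)⟩)
        (((rankSet_finite N 3).union (rankSet_finite N 4)).union (rankSet_finite N 5)) (rankSet_finite N 6),
      ncard_union_eq (Set.disjoint_union_left.mpr
        ⟨rankSet_disjoint_of_ne N (by norm_num), rankSet_disjoint_of_ne N (by norm_num)⟩)
        ((rankSet_finite N 3).union (rankSet_finite N 4)) (rankSet_finite N 5),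
      ncard_union_eq (rankSet_disjoint_of_ne N (by norm_num)) (rankSet_finite N 3) (rankSet_finite N 4)] at h0
    push_cast at h0
    exact h0
  rw [phiK_nine_four]
  have hU' : (({A : Set α | A ⊆ (M.disjointSum N h).E ∧ (M.disjointSum N h).eRk A = ((9 : ℕ) : ℕ∞) ∧
      (M.disjointSum N h).eRk ((M.disjointSum N h).E \ A) = ((4 : ℕ) : ℕ∞)}.ncard : ℕ) : ℚ) ≤
      20 * ((profileSet N 7 2).ncard : ℚ) := by
    exact_mod_cast hU
  have hY' : 26 * (((rankSet N 3).ncard : ℚ) + ((rankSet N 4).ncard : ℚ) + ((rankSet N 5).ncard : ℚ) +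
      ((rankSet N 6).ncard : ℚ)) ≤
      (({A : Set α | A ⊆ (M.disjointSum N h).E ∧ ((4 : ℕ) : ℕ∞) < (M.disjointSum N h).eRk A ∧
        (M.disjointSum N h).eRk A < ((9 : ℕ) : ℕ∞)}.ncard : ℕ) : ℚ) := by
    exact_mod_cast hY
  have hS : (0 : ℚ) ≤ ((rankSet N 3).ncard : ℚ) + ((rankSet N 4).ncard : ℚ) + ((rankSet N 5).ncard : ℚ) +
      ((rankSet N 6).ncard : ℚ) := by positivity
  exact consumer_arith_two_seven hU' h72 hY' hS

end S1

end PercRepro
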